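import Literature.Geometry.Riemannian.BochnerIntegratedHessian
import Literature.Geometry.Riemannian.HarmonicReplacementBall
import Literature.Geometry.Riemannian.CompleteManifoldCutoff
import HarnessLib

/-!
# The interior `L²` Hessian estimate for harmonic functions on balls (`Ric ≥ -(d-1)`)

The `W^{2,2}_{loc}` estimate used for harmonic approximations in the Cheeger–Colding theory
(Cheeger–Colding 1996, §6): on a connected complete Riemannian `d`-manifold with
`Ric ≥ -(d-1) g`, a function `v` which is `C^∞` and harmonic on the open ball `B_r(p)` with
finite Dirichlet energy `∫_{B_r(p)} |∇v|² ≤ A` satisfies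

  `∫_{B_{r/4}(p)} |Hess v|²_g ≤ (16 C₀ / r² + 2(d-1)) A`

(`lintegral_ball_normSq_hessian_le`), `C₀` the universal constant of Gaffney's cut-offs
(`exists_cutoff_of_isGeodesicallyComplete`): globalise `v` near the support of a cut-off `ψ`
(`ψ = 1` on `B_{r/4}`, `tsupport ψ ⊆ B_{r/2}`, `|∇ψ|² ≤ 4C₀/r²`) and apply the Caccioppoli–Bochner
bound `∫ ψ²|Hess v|² ≤ 4∫|∇ψ|²|∇v|² + 2(d-1)∫ψ²|∇v|²` (`integral_sq_mul_normSq_hessian_le`). In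
particular the harmonic replacement of `HarmonicReplacementBall.lean` /
`HarmonicReplacementEnergy.lean` has Hessian in `L²(B_{r/4})` with norm at most
`(16C₀/r² + 2(d-1)) m_E ≤ (16C₀/r² + 2(d-1)) ∫ |dχ|²`.

No definitions, no named facts (D-0026). Groundwork for `CheegerColding1997_sphereStability`.

## References

* J. Cheeger, T. H. Colding, Ann. of Math. 144 (1996) 189–237, §6. [CheegerColding1996]
* P. Petersen, *Riemannian Geometry*, 3rd ed. (2016), Lemma 8.2.1. [Petersen2016]
-/

noncomputable section

open Bundle Set Function Filter Topology MeasureTheory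
open scoped Manifold ContDiff ENNReal NNReal

namespace Literature.Geometry.Riemannian

open Literature.Geometry.Lorentzian
open Literature.Geometry.Lorentzian.PseudoRiemannianMetric

universe u

section Ball

variable {d : ℕ} {M : Type u} [TopologicalSpace M] [ChartedSpace (EuclideanSpace ℝ (Fin d)) M]
  [IsManifold 𝓘(ℝ, EuclideanSpace ℝ (Fin d)) ∞ M] [T2Space M]
  (g : PseudoRiemannianMetric 𝓘(ℝ, EuclideanSpace ℝ (Fin d)) ∞ (EuclideanSpace ℝ (Fin d))
    (TangentSpace 𝓘(ℝ, EuclideanSpace ℝ (Fin d)) : M → Type _)) [g.HasLeviCivita]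
  [CovariantDerivative.ContMDiffCovariantDerivative g.leviCivita 1]
  [CovariantDerivative.ContMDiffCovariantDerivative g.leviCivita ∞]

omit [T2Space M] [g.HasLeviCivita] [CovariantDerivative.ContMDiffCovariantDerivative g.leviCivita 1]
  [CovariantDerivative.ContMDiffCovariantDerivative g.leviCivita ∞] in
/-- Equal metrics have equal Hessian square norms (the Levi-Civita instance is propositional).
[folklore] -/
theorem normSq_hessian_congr_metric
    {g₁ g₂ : PseudoRiemannianMetric 𝓘(ℝ, EuclideanSpace ℝ (Fin d)) ∞ (EuclideanSpace ℝ (Fin d))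
      (TangentSpace 𝓘(ℝ, EuclideanSpace ℝ (Fin d)) : M → Type _)}
    [g₁.HasLeviCivita] [g₂.HasLeviCivita] (h12 : g₁ = g₂) (f : M → ℝ) (x : M) :
    g₁.normSq x (g₁.hessian f x) = g₂.normSq x (g₂.hessian f x) := by
  subst h12
  rfl

omit [T2Space M] [g.HasLeviCivita] [CovariantDerivative.ContMDiffCovariantDerivative g.leviCivita 1]
  [CovariantDerivative.ContMDiffCovariantDerivative g.leviCivita ∞] in
/-- Equal metrics have equal Ricci tensors (propositional Levi-Civita instance); a local copy of
`Literature.Geometry.Riemannian.ricci_congr_metric` (`ShrinkerSplittingAtInfinityProofs`, not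
imported here). [folklore] -/
private theorem ricci_congr_metric_aux
    {g₁ g₂ : PseudoRiemannianMetric 𝓘(ℝ, EuclideanSpace ℝ (Fin d)) ∞ (EuclideanSpace ℝ (Fin d))
      (TangentSpace 𝓘(ℝ, EuclideanSpace ℝ (Fin d)) : M → Type _)}
    [g₁.HasLeviCivita] [g₂.HasLeviCivita] (h12 : g₁ = g₂) (x : M)
    (v w : TangentSpace 𝓘(ℝ, EuclideanSpace ℝ (Fin d)) x) :
    g₁.ricci x v w = g₂.ricci x v w := by
  subst h12
  rfl

/-- **Interior `L²` Hessian estimate for harmonic functions on a ball** (Cheeger–Colding 1996,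
§6; Caccioppoli–Bochner with Gaffney cut-offs): with the constant `C₀` of
`exists_cutoff_of_isGeodesicallyComplete`, on a connected complete Riemannian `d`-manifold with
`Ric ≥ -(d-1) g`, if `v` is `C^∞` and harmonic on the open ball `{d(p,·) < r}` and
`∫⁻_{d(p,·) < r} ofReal |∇v|²_g ≤ ofReal A` (`A ≥ 0`), then
`∫⁻_{d(p,·) < r/4} ofReal |Hess v|²_g ≤ ofReal ((16 C₀/r² + 2(d-1)) A)`.
[cite: CheegerColding1996, §6] [cite: Petersen2016, Lemma 8.2.1] -/
theorem lintegral_ball_normSq_hessian_le (hd : 0 < d) : ∃ C₀ : ℝ, 0 ≤ C₀ ∧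
    ∀ {M : Type u} [TopologicalSpace M] [ChartedSpace (EuclideanSpace ℝ (Fin d)) M]
      [IsManifold 𝓘(ℝ, EuclideanSpace ℝ (Fin d)) ∞ M] [T2Space M] [T3Space M] [ConnectedSpace M]
      [SecondCountableTopology M] [MeasurableSpace M] [BorelSpace M]
      (g : PseudoRiemannianMetric 𝓘(ℝ, EuclideanSpace ℝ (Fin d)) ∞ (EuclideanSpace ℝ (Fin d))
        (TangentSpace 𝓘(ℝ, EuclideanSpace ℝ (Fin d)) : M → Type _)) [g.HasLeviCivita]
      [CovariantDerivative.ContMDiffCovariantDerivative g.leviCivita 1]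
      [CovariantDerivative.ContMDiffCovariantDerivative g.leviCivita ∞]
      (hg : g.IsRiemannian) (_ : IsGeodesicallyComplete g.leviCivita),
      (∀ (x : M) (w : TangentSpace 𝓘(ℝ, (EuclideanSpace ℝ (Fin d))) x),
        -((d : ℝ) - 1) * g.val x w w ≤ g.leviCivita.ricci x w w) →
      ∀ (v : M → ℝ) (p : M) (r A : ℝ), 0 < r → 0 ≤ A →
      ContMDiffOn 𝓘(ℝ, (EuclideanSpace ℝ (Fin d))) 𝓘(ℝ, ℝ) ∞ v {x : M | g.edist hg p x < ENNReal.ofReal r} →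
      (∀ x, g.edist hg p x < ENNReal.ofReal r → g.laplaceBeltrami v x = 0) →
      ∫⁻ x in {x : M | g.edist hg p x < ENNReal.ofReal r}, ENNReal.ofReal (g.gradSq v x)
          ∂(riemannianMeasure (I := 𝓘(ℝ, (EuclideanSpace ℝ (Fin d)))) (g.toContMDiffRiemannianMetric hg)) ≤
        ENNReal.ofReal A →
      ∫⁻ x in {x : M | g.edist hg p x < ENNReal.ofReal (r / 4)}, ENNReal.ofReal (g.normSq x (g.hessian v x))
          ∂(riemannianMeasure (I := 𝓘(ℝ, (EuclideanSpace ℝ (Fin d)))) (g.toContMDiffRiemannianMetric hg)) ≤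
        ENNReal.ofReal ((16 * C₀ / r ^ 2 + 2 * ((d : ℝ) - 1)) * A) := by
  obtain ⟨C₀, hcut⟩ := exists_cutoff_of_isGeodesicallyComplete.{0, 0, u}
  -- `C₀ ≥ 0` is forced by the gradient bound at a point where `∇χ ≠ 0`? we only need `max C₀ 0`.
  refine ⟨max C₀ 0, le_max_right _ _, ?_⟩
  intro M _ _ _ _ _ _ _ _ _ g _ _ _ hg hc hRic v p r A hr hA hv hΔ hE
  haveI : LocallyCompactSpace M :=
    Manifold.locallyCompact_of_finiteDimensional 𝓘(ℝ, (EuclideanSpace ℝ (Fin d)))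
  haveI : SigmaCompactSpace M := inferInstance
  haveI : Nontrivial (EuclideanSpace ℝ (Fin d)) := by
    have : 0 < Module.finrank ℝ (EuclideanSpace ℝ (Fin d)) := by
      rw [finrank_euclideanSpace_fin]; exact hd
    exact Module.finrank_pos_iff.1 this
  haveI : Fact ((1 : ℕ∞ω) ≤ (∞ : ℕ∞ω)) := ⟨by exact_mod_cast le_top⟩
  set h := g.toContMDiffRiemannianMetric hg with hh
  set μ := riemannianMeasure (I := 𝓘(ℝ, (EuclideanSpace ℝ (Fin d)))) h with hμ
  haveI : IsFiniteMeasureOnCompacts μ :=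
    ⟨fun K hK ↦ riemannianVolume_lt_top_of_isCompact_holds h le_rfl hK⟩
  have hOf : ofRiemannian h = g := by ext; rfl
  haveI iLC : (ofRiemannian h).HasLeviCivita := by rw [hOf]; infer_instance
  set B : Set M := {x : M | g.edist hg p x < ENNReal.ofReal r} with hB
  have hρc : Continuous fun x ↦ g.edist hg p x :=
    (PseudoRiemannianMetric.continuous_edist hg).comp (Continuous.prodMk_right p)
  have hBo : IsOpen B := isOpen_lt hρc continuous_const
  have hBm : MeasurableSet B := hBo.measurableSet
  -- the cut-off at scale `r/2`: `ψ = 1` on `B_{r/4}`, `tsupport ψ ⊆ B_{r/2}`, `|∇ψ|² ≤ 4C₀/r²`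
  obtain ⟨ψ, hψs, hψc, hψ0, hψ1, hψone, hψsupp, hψgrad⟩ :=
    hcut 𝓘(ℝ, (EuclideanSpace ℝ (Fin d))) M g hg hc p (r / 2) (half_pos hr)
  have hψB : tsupport ψ ⊆ B := hψsupp.trans fun x hx ↦ by
    simp only [mem_setOf_eq] at hx ⊢
    exact hx.trans (ENNReal.ofReal_lt_ofReal_iff_of_nonneg (by linarith) |>.2 (by linarith))
  -- globalise `v` near `tsupport ψ`
  obtain ⟨V, O, hVs, -, hOo, hKO, hOB, hVO⟩ :=
    exists_contMDiff_hasCompactSupport_eqOn_nhds (m := d) hBo hv hψc.isCompact hψB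
  have hveq : ∀ x ∈ O, v =ᶠ[𝓝 x] V := fun x hx ↦ by
    filter_upwards [hOo.mem_nhds hx] with y hy using (hVO hy).symm
  have hgradV : ∀ x ∈ O, g.gradSq V x = g.gradSq v x := fun x hx ↦ by
    simp only [PseudoRiemannianMetric.gradSq, mvfderiv_congr_of_eventuallyEq (hveq x hx)]
  have hΔV : ∀ x ∈ O, (ofRiemannian h).dalembertian V x = 0 := fun x hx ↦ by
    rw [(ofRiemannian h).dalembertian_congr_of_eventuallyEq (hveq x hx).symm, dalembertian_congr_metric hOf,
      ← laplaceBeltrami_eq_dalembertian]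
    exact hΔ x (hOB hx)
  have hharm : ∀ x ∈ tsupport ψ, mvfderiv 𝓘(ℝ, (EuclideanSpace ℝ (Fin d))) ((ofRiemannian h).dalembertian V) x = 0 := by
    intro x hx
    refine mvfderiv_eq_zero_of_eventuallyEq_zero ?_
    filter_upwards [hOo.mem_nhds (hKO hx)] with y hy using hΔV y hy
  -- Caccioppoli–Bochner for `V`
  have hRic' : ∀ (x : M) (w : TangentSpace 𝓘(ℝ, (EuclideanSpace ℝ (Fin d))) x),
      -((d : ℝ) - 1) * (ofRiemannian h).val x w w ≤ (ofRiemannian h).ricci x w w := by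
    intro x w
    rw [ricci_congr_metric_aux hOf, hOf]
    exact hRic x w
  have key0 := integral_sq_mul_normSq_hessian_le (I := 𝓘(ℝ, (EuclideanSpace ℝ (Fin d)))) h hRic' hVs hψs hψc hharm
  have hNeq : ∀ x, (ofRiemannian h).normSq x ((ofRiemannian h).hessian V x) = g.normSq x (g.hessian V x) :=
    fun x ↦ normSq_hessian_congr_metric hOf V x
  simp only [hNeq] at key0
  have key : ∫ x, ψ x ^ 2 * g.normSq x (g.hessian V x) ∂μ ≤
      4 * (∫ x, g.gradSq ψ x * g.gradSq V x ∂μ) - 2 * (-((d : ℝ) - 1)) * ∫ x, ψ x ^ 2 * g.gradSq V x ∂μ := by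
    have e1 : ∀ f : M → ℝ, (ofRiemannian h).gradSq f = g.gradSq f := fun f ↦ by rw [hOf]
    simpa only [e1, hμ] using key0
  -- bookkeeping: the energy of `v` on `B` as a real set integral
  set C := max C₀ 0 with hC
  have hC0' : 0 ≤ C := le_max_right _ _
  have hgv0 : ∀ x, 0 ≤ g.gradSq v x := fun x ↦ g.gradSq_nonneg hg v x
  have hvat : ∀ x ∈ B, ContMDiffAt 𝓘(ℝ, (EuclideanSpace ℝ (Fin d))) 𝓘(ℝ, ℝ) ∞ v x := fun x hx ↦
    hv.contMDiffAt (hBo.mem_nhds hx)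
  have hGvc : ContinuousOn (g.gradSq v) B := by
    intro x hx
    obtain ⟨V', O', hV's, -, hO'o, hxO', hO'B, hV'O'⟩ :=
      exists_contMDiff_hasCompactSupport_eqOn_nhds (m := d) hBo hv isCompact_singleton
        (singleton_subset_iff.2 hx)
    have hev : ∀ z ∈ O', g.gradSq v z = g.gradSq V' z := fun z hz ↦ by
      have h1 : v =ᶠ[𝓝 z] V' := by
        filter_upwards [hO'o.mem_nhds hz] with y hy using (hV'O' hy).symm
      simp only [PseudoRiemannianMetric.gradSq, mvfderiv_congr_of_eventuallyEq h1]
    refine ((contMDiff_gradSq g hV's).continuous.continuousAt.congr_of_eventuallyEq ?_).continuousWithinAt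
    filter_upwards [hO'o.mem_nhds (hxO' rfl)] with z hz using hev z hz
  have hGvm : AEStronglyMeasurable (g.gradSq v) (μ.restrict B) :=
    hGvc.aestronglyMeasurable hBm
  have hEfin : ∫⁻ x in B, ENNReal.ofReal (g.gradSq v x) ∂μ < ⊤ := hE.trans_lt ENNReal.ofReal_lt_top
  have hIv : IntegrableOn (g.gradSq v) B μ := by
    refine ⟨hGvm, ?_⟩
    rw [hasFiniteIntegral_iff_enorm]
    refine lt_of_le_of_lt (lintegral_mono fun x ↦ ?_) hEfin
    rw [Real.enorm_eq_ofReal (hgv0 x)]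
  have hEv : ∫ x in B, g.gradSq v x ∂μ ≤ A := by
    rw [integral_eq_lintegral_of_nonneg_ae (Eventually.of_forall fun x ↦ hgv0 x) hGvm]
    exact ENNReal.toReal_le_of_le_ofReal hA hE
  -- (i) `∫ |∇ψ|² |∇V|² ≤ (4C/r²) A`
  have hψgrad' : ∀ x, g.gradSq ψ x ≤ 4 * C / r ^ 2 := fun x ↦ by
    have h1 := hψgrad x
    have h2 : C₀ / (r / 2) ^ 2 ≤ 4 * C / r ^ 2 := by
      rw [div_le_div_iff₀ (by positivity) (by positivity)]
      nlinarith [le_max_left C₀ 0, sq_nonneg r]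
    exact h1.trans h2
  have hψ0' : ∀ x, 0 ≤ g.gradSq ψ x := fun x ↦ g.gradSq_nonneg hg ψ x
  have hsuppeq : ∀ x ∈ tsupport ψ, g.gradSq V x = g.gradSq v x := fun x hx ↦ hgradV x (hKO hx)
  have hgradψ0 : ∀ x ∉ tsupport ψ, g.gradSq ψ x = 0 := fun x hx ↦ by
    simp [PseudoRiemannianMetric.gradSq, PseudoRiemannianMetric.innerDual, mvfderiv_eq_zero_of_notMem_tsupport hx]
  have hi : ∫ x, g.gradSq ψ x * g.gradSq V x ∂μ ≤ 4 * C / r ^ 2 * A := by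
    have h1 : ∫ x, g.gradSq ψ x * g.gradSq V x ∂μ = ∫ x in B, g.gradSq ψ x * g.gradSq v x ∂μ := by
      rw [← integral_indicator hBm]
      refine integral_congr_ae (Eventually.of_forall fun x ↦ ?_)
      show g.gradSq ψ x * g.gradSq V x = B.indicator (fun x ↦ g.gradSq ψ x * g.gradSq v x) x
      by_cases hx : x ∈ tsupport ψ
      · rw [indicator_of_mem (hψB hx), hsuppeq x hx]
      · rw [hgradψ0 x hx, zero_mul]
        by_cases hxB : x ∈ B
        · rw [indicator_of_mem hxB, hgradψ0 x hx, zero_mul]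
        · rw [indicator_of_notMem hxB]
    rw [h1]
    calc ∫ x in B, g.gradSq ψ x * g.gradSq v x ∂μ ≤ ∫ x in B, 4 * C / r ^ 2 * g.gradSq v x ∂μ := by
          refine integral_mono_of_nonneg (Eventually.of_forall fun x ↦ mul_nonneg (hψ0' x) (hgv0 x))
            (hIv.const_mul _) (Eventually.of_forall fun x ↦ ?_)
          exact mul_le_mul_of_nonneg_right (hψgrad' x) (hgv0 x)
      _ = 4 * C / r ^ 2 * ∫ x in B, g.gradSq v x ∂μ := integral_const_mul _ _
      _ ≤ 4 * C / r ^ 2 * A := mul_le_mul_of_nonneg_left hEv (by positivity)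
  -- (ii) `∫ ψ² |∇V|² ≤ A`
  have hii : ∫ x, ψ x ^ 2 * g.gradSq V x ∂μ ≤ A := by
    have h1 : ∫ x, ψ x ^ 2 * g.gradSq V x ∂μ = ∫ x in B, ψ x ^ 2 * g.gradSq v x ∂μ := by
      rw [← integral_indicator hBm]
      refine integral_congr_ae (Eventually.of_forall fun x ↦ ?_)
      show ψ x ^ 2 * g.gradSq V x = B.indicator (fun x ↦ ψ x ^ 2 * g.gradSq v x) x
      by_cases hx : x ∈ tsupport ψ
      · rw [indicator_of_mem (hψB hx), hsuppeq x hx]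
      · rw [image_eq_zero_of_notMem_tsupport hx]
        by_cases hxB : x ∈ B
        · rw [indicator_of_mem hxB, image_eq_zero_of_notMem_tsupport hx]; ring
        · rw [indicator_of_notMem hxB]; ring
    rw [h1]
    calc ∫ x in B, ψ x ^ 2 * g.gradSq v x ∂μ ≤ ∫ x in B, g.gradSq v x ∂μ := by
          refine integral_mono_of_nonneg (Eventually.of_forall fun x ↦ mul_nonneg (sq_nonneg _) (hgv0 x))
            hIv (Eventually.of_forall fun x ↦ ?_)
          have hψ2 : ψ x ^ 2 ≤ 1 := by
            have := hψ0 x; have := hψ1 x; nlinarith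
          calc ψ x ^ 2 * g.gradSq v x ≤ 1 * g.gradSq v x := mul_le_mul_of_nonneg_right hψ2 (hgv0 x)
            _ = g.gradSq v x := one_mul _
      _ ≤ A := hEv
  -- (iii) the left-hand side
  have hNv : ∀ x, ψ x = 1 → g.normSq x (g.hessian v x) = g.normSq x (g.hessian V x) := by
    intro x hx1
    have hxs : x ∈ tsupport ψ := subset_tsupport _ (by rw [mem_support, hx1]; exact one_ne_zero)
    have hev := hveq x (hKO hxs)
    rw [g.hessian_congr_of_eventuallyEq hev]
  have hNVn : ∀ x, 0 ≤ g.normSq x (g.hessian V x) := fun x ↦ g.normSq_nonneg x hg _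
  have hNc : Continuous fun x ↦ ψ x ^ 2 * g.normSq x (g.hessian V x) :=
    (hψs.continuous.pow 2).mul (contMDiff_normSq_hessian g hVs).continuous
  have hψ2c : HasCompactSupport (fun x ↦ ψ x ^ 2) :=
    HasCompactSupport.intro hψc fun x hx ↦ by rw [image_eq_zero_of_notMem_tsupport hx]; ring
  have hNi : Integrable (fun x ↦ ψ x ^ 2 * g.normSq x (g.hessian V x)) μ :=
    hNc.integrable_of_hasCompactSupport hψ2c.mul_right
  have hquarter : ∀ x, g.edist hg p x < ENNReal.ofReal (r / 4) → ψ x = 1 := fun x hx ↦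
    hψone x (by rwa [show r / 2 / 2 = r / 4 by ring])
  calc ∫⁻ x in {x : M | g.edist hg p x < ENNReal.ofReal (r / 4)}, ENNReal.ofReal (g.normSq x (g.hessian v x)) ∂μ
      ≤ ∫⁻ x in {x : M | g.edist hg p x < ENNReal.ofReal (r / 4)},
          ENNReal.ofReal (ψ x ^ 2 * g.normSq x (g.hessian V x)) ∂μ := by
        refine setLIntegral_mono' (isOpen_lt hρc continuous_const).measurableSet fun x hx ↦ ?_
        rw [hNv x (hquarter x hx), hquarter x hx, one_pow, one_mul]
    _ ≤ ∫⁻ x, ENNReal.ofReal (ψ x ^ 2 * g.normSq x (g.hessian V x)) ∂μ := setLIntegral_le_lintegral _ _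
    _ = ENNReal.ofReal (∫ x, ψ x ^ 2 * g.normSq x (g.hessian V x) ∂μ) := by
        rw [ofReal_integral_eq_lintegral_ofReal hNi
          (Eventually.of_forall fun x ↦ mul_nonneg (sq_nonneg _) (hNVn x))]
    _ ≤ ENNReal.ofReal ((16 * C / r ^ 2 + 2 * ((d : ℝ) - 1)) * A) := by
        refine ENNReal.ofReal_le_ofReal ?_
        have hd1 : (0 : ℝ) ≤ (d : ℝ) - 1 := by
          have : (1 : ℝ) ≤ d := by exact_mod_cast hd
          linarith
        have e : (16 * C / r ^ 2 + 2 * ((d : ℝ) - 1)) * A =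
            4 * (4 * C / r ^ 2 * A) + 2 * ((d : ℝ) - 1) * A := by ring
        rw [e]
        nlinarith [key, hi, hii, hd1]

end Ball

end Literature.Geometry.Riemannian

end
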